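import Literature.AlgebraicGeometry.HodgeTheory.CycleClassOfResolutions
import Literature.AlgebraicGeometry.Motives.SubschemeCyclesPushPullProofs
import HarnessLib

/-!
# Consequences of the degree formula for the cycle class through desingularisations:
# `[ι(V)] = ι_* 1`, independence of the resolutions, and `[f_* Z] = f_* [Z]` (Prop. 9.21 (ii))

Family `hodge`, layer `Literature/AlgebraicGeometry/HodgeTheory`. Sequel to
`HodgeTheory/CycleClassOfResolutions` (the real definition `cycleClass μ hX hde ρ : Z_d(X) →+ H^{2e}(X(ℂ); ℂ)`,
`[Z] = Σ_z Z(z) • τ_z* 1`, Voisin I §11.1.4, through a resolution family `ρ` and relative to an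
orientation family `μ`; and the hypothesis predicate `μ.HasDegreeFormula` — W. Fulton, *Intersection
Theory* (1998), Lemma 19.1.2 (p. 371): "Let `f : V → W` be a proper, surjective morphism of varieties.
Then `f_* cl(V) = deg(V/W) · cl(W)`", pushed into a smooth projective ambient and read through a
desingularisation of `W`: `g_* 1_V = k • τ_* 1_{W̃}`, `k = [K(V) : K(W)]`). Everything here is PROVED
from `μ.HasDegreeFormula` (theorems only, no definition, no named fact):

* `complexGysin_one_eq_zero_of_height_lt` — **`g_* 1 = 0` in `H^{2e}` when `dim g(V) < dim V`** (for
  EVERY `μ`: the class dies off `closure (g V)`, of codimension `> e`, and semipurity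
  `injective_restrictCompl_of_le_coheight`, Voisin I Lemma 11.13) — the case "`f_*[V] = 0` if
  `dim f(V) < dim V`" of Fulton §1.4;
* `complexGysin_one_eq_smul_cycleClass` — `g_* 1_V = k • [closure {z}]`;
* `cycleClass_primeCycle_of_isClosedImmersion` — **`[ι(V)] = ι_* 1_V`** for a closed immersion
  `ι : V ↪ X` of smooth projective varieties (the field `cl_primeCycle` of `GysinFormalism`; Voisin I
  §11.1.4 "`[Z_i] = PD(j_{i*}([Z̃_i]_fund))`");
* `cycleClass_eq_of_hasDegreeFormula` — `[Z]` does not depend on the resolution family (Voisin I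
  §11.1.4: the class `τ_*(1_{Z̃})` is independent of the desingularisation);
* `cycleClass_cyclesOfDimMap` — **`[f_* Z] = f_* [Z]`** for `f : Y ⟶ X` between smooth projective
  varieties (Voisin II Prop. 9.21 (ii) "If `i` is proper and `Z ∈ CHᵏ(Y)`, then `cl(i_*Z) = i_* cl(Z)`";
  Fulton §19.1 "`cl` commutes with push-forward for proper morphisms" — the field `cl_map` of
  `GysinFormalism`): on a prime cycle `[closure {y}]`, either the dimension drops and both sides vanish
  (`f_*[closure {y}] = 0`; `(τ_y ≫ f)_* 1 = 0` by semipurity), or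
  `f_*[closure {y}] = [κ(y) : κ(f y)] [closure {f y}]` (Fulton §1.4, Mathlib's weighted push-forward)
  and the degree formula applies to `g = τ_y ≫ f`;
* the additive-extension principle `AddMonoidHom.cyclesOfDim_ext` (two homomorphisms on `Z_d(X)`
  agreeing on prime cycles agree; Fulton §1.3).

## References

* [Fulton1998] W. Fulton, Intersection Theory, 2nd ed., Springer 1998, §1.3, §1.4, Lemma 19.1.2, §19.1.
* [VoisinHodgeI2002] C. Voisin, Hodge Theory and Complex Algebraic Geometry I, CUP 2002, §11.1.2
  Lemma 11.13, §11.1.4.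
* [VoisinHodgeII2003] C. Voisin, Hodge Theory and Complex Algebraic Geometry II, CUP 2003, §9.2.4
  Prop. 9.21 (ii), proof of Lemma 9.18.
* [StacksProject] The Stacks project, Tags 02R5 (functoriality of push-forward), 02JW (dimension formula).
* [Hartshorne1977] R. Hartshorne, Algebraic Geometry, II Ex. 3.20.
-/

noncomputable section

open CategoryTheory AlgebraicGeometry Order
open Literature.AlgebraicTopology.SingularHomology

namespace Literature.AlgebraicGeometry.HodgeTheory

section HodgeTheory

variable {m n : ℕ} {Y X : Motives.SchemeOver ℂ}

/-! ### Bookkeeping: heights and push-forwards of prime cycles -/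

/-- If `g_*[closure {η}] = k • [closure {z}]` with `k ≠ 0`, then `g η = z`. [cite: Fulton1998, §1.4] -/
theorem base_eq_of_map_primeCycle_eq_nsmul {V : Motives.SchemeOver ℂ} (g : V ⟶ X)
    [QuasiCompact g.left] {η : V.left} {z : X.left} {k : ℕ} (hk : k ≠ 0)
    (h : AlgebraicCycle.map g.left height height (Motives.primeCycle η) = k • Motives.primeCycle z) :
    g.left.base η = z := by
  classical
  by_contra hne
  have h1 := congrArg (fun c : AlgebraicCycle X.left ℤ ↦ c z) h
  simp only [Motives.algebraicCycleMap_primeCycle_eq_nsmul, Function.locallyFinsuppWithin.coe_nsmul,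
    Pi.smul_apply, Motives.primeCycle_apply_self, Motives.primeCycle_apply_of_ne (Ne.symm hne),
    smul_zero, nsmul_eq_mul, mul_one] at h1
  exact hk (by exact_mod_cast h1.symm)

/-- If `g_*[closure {η}] = k • [closure {z}]` with `k ≠ 0`, then `dim closure {z} = dim closure {η}`.
[cite: Fulton1998, §1.4] -/
theorem height_eq_of_map_primeCycle_eq_nsmul {V : Motives.SchemeOver ℂ} (g : V ⟶ X)
    [QuasiCompact g.left] {η : V.left} {z : X.left} {k : ℕ} (hk : k ≠ 0)
    (h : AlgebraicCycle.map g.left height height (Motives.primeCycle η) = k • Motives.primeCycle z) :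
    height z = height η := by
  classical
  have hz := base_eq_of_map_primeCycle_eq_nsmul g hk h
  subst hz
  have h1 := congrArg (fun c : AlgebraicCycle X.left ℤ ↦ c (g.left.base η)) h
  simp only [Motives.algebraicCycleMap_primeCycle_eq_nsmul, Function.locallyFinsuppWithin.coe_nsmul,
    Pi.smul_apply, Motives.primeCycle_apply_self, nsmul_eq_mul, mul_one] at h1
  by_contra hne
  simp only [AlgebraicCycle.mapCoeff, if_neg (Ne.symm hne), Nat.cast_zero] at h1
  exact hk (by exact_mod_cast h1.symm)

/-- The generic point of a smooth projective `d`-fold has dimension `d`. [cite: Hartshorne1977, II Ex. 3.20] -/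
theorem height_eq_of_isGenericPoint {d : ℕ} {V : Motives.SchemeOver ℂ}
    (hV : Motives.IsSmoothProjective d V) {η : V.left} (hη : IsGenericPoint η Set.univ) :
    height η = d := by
  haveI := irreducibleSpace_of_isSmoothProjective' hV
  obtain ⟨a, c, ha, hc, hac⟩ := exists_height_eq_coheight_eq hV η
  have hη' : η = genericPoint V.left := hη.eq (genericPoint_spec V.left)
  have hc0 : coheight η = 0 := by
    rw [Order.coheight_eq_zero]
    intro y hy
    rw [hη']
    exact Scheme.le_iff_specializes.2 ((genericPoint_spec V.left).specializes (Set.mem_univ y))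
  rw [hc] at hc0
  have : c = 0 := by exact_mod_cast hc0
  rw [ha]
  exact_mod_cast (show a = d by omega)

/-- **Points of the same dimension as their image have finite residue extension** (over `ℂ`): if
`dim closure {x} = dim closure {f x} = d` then the push-forward coefficient `[κ(x) : κ(f x)]` of `f_*`
at `x` is non-zero — by the dimension formula `dim x = dim (f x) + dim_{fibre} x` (Stacks 02JW), `x` is
closed in its fibre, so its residue extension is finite (Stacks 01TB). (The same eight lines as
`Motives.mapCoeff_ne_zero_of_height_eq` of `Motives/LinesGenerateChowOneRational`, not imported here.)
[cite: StacksProject, Tag 02JW] -/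
theorem mapCoeff_ne_zero_of_height_eq_of_isSmoothProjective (hY : Motives.IsSmoothProjective m Y)
    (hX : Motives.IsSmoothProjective n X) (f : Y ⟶ X) (y : Y.left) {d : ℕ}
    (hy : height y = d) (hfy : height (f.left.base y) = d) :
    AlgebraicCycle.mapCoeff f.left height height y ≠ 0 := by
  haveI : LocallyOfFiniteType X.hom := locallyOfFiniteType_of_isSmoothProjective hX
  haveI : LocallyOfFiniteType (f.left ≫ X.hom) := by
    rw [Over.w f]; exact locallyOfFiniteType_of_isSmoothProjective hY
  haveI : LocallyOfFiniteType f.left := locallyOfFiniteType_of_comp f.left X.hom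
  rw [Motives.mapCoeff_height_eq_residueDegree f.left X.hom y]
  apply Motives.residueDegree_ne_zero_of_height_asFiber_eq_zero
  have h := Motives.Scheme.height_eq_height_add_height_asFiber f.left X.hom y
  rw [hy, hfy] at h
  have h' : (d : ℕ∞) + height (f.left.asFiber y) = d + 0 := by rw [add_zero]; exact h.symm
  exact ENat.add_right_injective_of_ne_top (ENat.coe_ne_top d) h'

/-! ### Vanishing of Gysin images through small subvarieties (semipurity) -/

/-- **A Gysin image `g_* 1 ∈ H^{2e}(X(ℂ); ℂ)` through a subvariety of dimension `< d` vanishes**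
(`d + e = dim X`): for `g : V ⟶ X`, `V` smooth projective of dimension `d` with generic point `η`, if
`dim closure {g η} < d` then `g_* 1 = 0` — the class dies off `closure {g η}`
(`complexGysin_one_restrictCompl_eq_zero`), all of whose points have codimension `≥ e + 1`, and
`H^{2e}(X(ℂ)) → H^{2e}((X ∖ T)(ℂ))` is one-to-one for `codim T > e` (semipurity,
`injective_restrictCompl_of_le_coheight`, Voisin I Lemma 11.13). This is the case "`f_*[V] = 0` if
`dim f(V) < dim V`" of the push-forward. [cite: Fulton1998, §1.4 and Lemma 19.1.2]
[cite: VoisinHodgeI2002, §11.1.2 Lemma 11.13] -/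
theorem complexGysin_one_eq_zero_of_height_lt (μ : OrientationFamily) {d : ℕ}
    {V : Motives.SchemeOver ℂ} (hV : Motives.IsSmoothProjective d V)
    (hX : Motives.IsSmoothProjective n X) (g : V ⟶ X) {e : ℕ} (hde : d + e = n)
    (h : 0 + 2 * n = 2 * e + 2 * d) {η : V.left} (hη : IsGenericPoint η Set.univ)
    (hlt : Order.height (g.left.base η) < (d : ℕ∞)) :
    complexGysin μ hV hX g h (singularCohomology.one ℂ (Motives.ComplexPoints V)) = 0 := by
  set T : Set X.left := closure {g.left.base η} with hT
  have hTc : IsClosed T := isClosed_closure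
  have hcoh : ∀ t ∈ T, ((e + 1 : ℕ) : ℕ∞) ≤ Order.coheight t := by
    intro t ht
    obtain ⟨a, c, ha, hc, hac⟩ := exists_height_eq_coheight_eq hX t
    have h1 := height_le_height_of_mem_closure ht
    rw [ha] at h1
    have h2 : (a : ℕ∞) < d := lt_of_le_of_lt h1 hlt
    have h2' : a < d := by exact_mod_cast h2
    rw [hc]
    exact_mod_cast (show e + 1 ≤ c by omega)
  refine injective_restrictCompl_of_le_coheight hX hTc hcoh (i := 2 * e) (by omega) ?_
  rw [map_zero]
  exact complexGysin_one_restrictCompl_eq_zero μ hV hX g h hη hTc (subset_closure rfl)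

/-! ### Consequences of the degree formula -/

/-- **`g_* 1_V = k • [closure {z}]`**: the Gysin image of `1` along `g : V ⟶ X` with
`g_*[V] = k • [closure {z}]`, `k ≥ 1`, is `k` times the cycle class of the prime cycle of `z` through
ANY resolution family. [cite: Fulton1998, Lemma 19.1.2] [cite: VoisinHodgeI2002, §11.1.4] -/
theorem complexGysin_one_eq_smul_cycleClass {μ : OrientationFamily} (hμ : μ.HasDegreeFormula)
    (hX : Motives.IsSmoothProjective n X) {d e : ℕ} (hde : d + e = n) (ρ : ResolutionFamily X d)
    {V : Motives.SchemeOver ℂ} (hV : Motives.IsSmoothProjective d V) (g : V ⟶ X) [QuasiCompact g.left]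
    {η : V.left} (hη : IsGenericPoint η Set.univ) {z : X.left} {k : ℕ} (hk : 0 < k)
    (h : AlgebraicCycle.map g.left height height (Motives.primeCycle η) = k • Motives.primeCycle z)
    (hmem : Motives.primeCycle z ∈ Motives.cyclesOfDim X.left d) :
    complexGysin μ hV hX g (show 0 + 2 * n = 2 * e + 2 * d by omega)
        (singularCohomology.one ℂ (Motives.ComplexPoints V)) =
      (k : ℂ) • cycleClass μ hX hde ρ ⟨Motives.primeCycle z, hmem⟩ := by
  have hz : height z = d := by
    rw [height_eq_of_map_primeCycle_eq_nsmul g hk.ne' h, height_eq_of_isGenericPoint hV hη]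
  rw [cycleClass_primeCycle_eq μ hX hde ρ z hz hmem]
  exact hμ hX hV (ρ.smooth ⟨z, hz⟩) hde g (ρ.hom ⟨z, hz⟩) hη (ρ.isGenericPoint_gen ⟨z, hz⟩) hk h
    (ρ.map_primeCycle ⟨z, hz⟩)

/-- **`[ι(V)] = ι_* 1_V` for a smooth closed subvariety** (the field `cl_primeCycle` of
`GysinFormalism` for `cycleClass`, granted the degree formula): for a closed immersion `ι : V ↪ X` of
smooth projective varieties and the generic point `δ` of `ι(V)`, the class of the prime cycle
`[ι(V)]` through any resolution family is `ι_*(1_V)` (`ι_*[V] = [ι(V)]` for cycles, degree `1`;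
"`[Z_i] = PD(j_{i*}([Z̃_i]_fund))`"). [cite: VoisinHodgeI2002, §11.1.4]
[cite: VoisinHodgeII2003, proof of Lemma 9.18] [cite: Fulton1998, Lemma 19.1.2] -/
theorem cycleClass_primeCycle_of_isClosedImmersion {μ : OrientationFamily} (hμ : μ.HasDegreeFormula)
    {d : ℕ} {V : Motives.SchemeOver ℂ} (hV : Motives.IsSmoothProjective d V)
    (hX : Motives.IsSmoothProjective n X) (ι : V ⟶ X) [IsClosedImmersion ι.left] {e : ℕ}
    (hde : d + e = n) (ρ : ResolutionFamily X d) (δ : X.left)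
    (hδ : IsGenericPoint δ (Set.range ι.left.base))
    (hmem : Motives.primeCycle δ ∈ Motives.cyclesOfDim X.left d) :
    cycleClass μ hX hde ρ ⟨Motives.primeCycle δ, hmem⟩ =
      complexGysin μ hV hX ι (show 0 + 2 * n = 2 * e + 2 * d by omega)
        (singularCohomology.one ℂ (Motives.ComplexPoints V)) := by
  haveI := irreducibleSpace_of_isSmoothProjective' hV
  -- the generic point of `V` maps to `δ`
  have hgen : ι.left.base (genericPoint V.left) = δ := by
    refine IsGenericPoint.eq ?_ hδ
    have h := (genericPoint_spec V.left).image ι.left.continuous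
    rwa [Set.image_univ, ι.left.isClosedEmbedding.isClosed_range.closure_eq] at h
  have hmap : AlgebraicCycle.map ι.left height height (Motives.primeCycle (genericPoint V.left)) =
      1 • Motives.primeCycle δ := by
    rw [one_smul, Motives.algebraicCycleMap_primeCycle ι.left, hgen]
  rw [complexGysin_one_eq_smul_cycleClass hμ hX hde ρ hV ι (genericPoint_spec V.left) one_pos hmap
    hmem, Nat.cast_one, one_smul]

/-- **The cycle class does not depend on the resolution family**, granted the degree formula
(Voisin I §11.1.4: "`[Z]` … does not depend on the choice of desingularization"): on each prime cycle
`[closure {z}]`, `τ_z* 1 = τ'_z* 1` is the degree formula with `k = 1`.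
[cite: VoisinHodgeI2002, §11.1.4] [cite: Fulton1998, Lemma 19.1.2] -/
theorem primeClass_eq_of_hasDegreeFormula {μ : OrientationFamily} (hμ : μ.HasDegreeFormula)
    (hX : Motives.IsSmoothProjective n X) {d e : ℕ} (hde : d + e = n)
    (ρ ρ' : ResolutionFamily X d) (z : X.left) :
    primeClass μ hX hde ρ z = primeClass μ hX hde ρ' z := by
  by_cases hz : height z = (d : ℕ∞)
  · rw [primeClass_of_height_eq μ hX hde ρ hz, primeClass_of_height_eq μ hX hde ρ' hz]
    have h := hμ hX (ρ.smooth ⟨z, hz⟩) (ρ'.smooth ⟨z, hz⟩) hde (ρ.hom ⟨z, hz⟩) (ρ'.hom ⟨z, hz⟩)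
      (ρ.isGenericPoint_gen ⟨z, hz⟩) (ρ'.isGenericPoint_gen ⟨z, hz⟩) one_pos
      (by rw [one_smul]; exact ρ.map_primeCycle ⟨z, hz⟩) (ρ'.map_primeCycle ⟨z, hz⟩)
    rw [h, Nat.cast_one, one_smul]
  · rw [primeClass_of_height_ne μ hX hde ρ hz, primeClass_of_height_ne μ hX hde ρ' hz]

/-- **Independence of the resolution family** for the additive cycle class.
[cite: VoisinHodgeI2002, §11.1.4] -/
theorem cycleClass_eq_of_hasDegreeFormula {μ : OrientationFamily} (hμ : μ.HasDegreeFormula)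
    (hX : Motives.IsSmoothProjective n X) {d e : ℕ} (hde : d + e = n)
    (ρ ρ' : ResolutionFamily X d) : cycleClass μ hX hde ρ = cycleClass μ hX hde ρ' := by
  ext Z
  rw [cycleClass_apply, cycleClass_apply]
  exact finsum_congr fun z ↦ by rw [primeClass_eq_of_hasDegreeFormula hμ hX hde ρ ρ' z]

/-! ### Additive extension from prime cycles -/

/-- A finitely supported cycle is the finite sum of its prime cycles with their multiplicities
(Fulton §1.3). [cite: Fulton1998, §1.3] -/
theorem eq_sum_zsmul_primeCycle_of_support_subset {S : Scheme} (c : AlgebraicCycle S ℤ)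
    {s : Finset S} (hs : ∀ z, c z ≠ 0 → z ∈ s) : c = ∑ p ∈ s, c p • Motives.primeCycle p := by
  classical
  ext z
  simp only [Function.locallyFinsuppWithin.coe_sum, Function.locallyFinsuppWithin.coe_zsmul,
    Finset.sum_apply, Pi.smul_apply, smul_eq_mul]
  by_cases hz : z ∈ s
  · rw [Finset.sum_eq_single_of_mem z hz (fun p _ hp ↦ by
        rw [Motives.primeCycle_apply_of_ne (Ne.symm hp), mul_zero]),
      Motives.primeCycle_apply_self, mul_one]
  · rw [Finset.sum_eq_zero (fun p hp ↦ ?_)]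
    · by_contra h
      exact hz (hs z h)
    · rw [Motives.primeCycle_apply_of_ne (fun h : z = p ↦ hz (by rw [h]; exact hp)), mul_zero]

/-- **Additive extension from prime cycles**: two homomorphisms on `Z_d(X)` (`X` smooth projective)
which agree on the prime cycles `[closure {z}]`, `dim closure {z} = d`, are equal — every `d`-cycle is
a finite `ℤ`-combination of such prime cycles. [cite: Fulton1998, §1.3] -/
theorem AddMonoidHom.cyclesOfDim_ext (hX : Motives.IsSmoothProjective n X) {d : ℕ} {A : Type*}
    [AddCommGroup A] {φ ψ : ↥(Motives.cyclesOfDim X.left d) →+ A}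
    (h : ∀ (z : X.left) (hz : height z = (d : ℕ∞)),
      φ ⟨Motives.primeCycle z, Motives.primeCycle_mem_cyclesOfDim hz⟩ =
        ψ ⟨Motives.primeCycle z, Motives.primeCycle_mem_cyclesOfDim hz⟩) :
    φ = ψ := by
  classical
  refine AddMonoidHom.ext fun Z ↦ ?_
  set s := (finite_support_of_isSmoothProjective hX (Z : AlgebraicCycle X.left ℤ)).toFinset with hs
  have hmem : ∀ z ∈ s, height z = (d : ℕ∞) := fun z hz ↦ Z.2 z (by simpa [hs] using hz)
  set T : ↥(Motives.cyclesOfDim X.left d) := ∑ z ∈ s.attach,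
    ((Z : AlgebraicCycle X.left ℤ) z.1) •
      (⟨Motives.primeCycle z.1, Motives.primeCycle_mem_cyclesOfDim (hmem z.1 z.2)⟩ :
        ↥(Motives.cyclesOfDim X.left d)) with hT
  have hZT : Z = T := by
    apply Subtype.ext
    rw [hT, AddSubgroup.val_finsetSum]
    simp only [AddSubgroupClass.coe_zsmul]
    rw [Finset.sum_attach s fun z ↦ ((Z : AlgebraicCycle X.left ℤ) z) • Motives.primeCycle z]
    exact eq_sum_zsmul_primeCycle_of_support_subset _ fun z hz ↦ by simpa [hs] using hz
  rw [hZT, map_sum, map_sum]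
  exact Finset.sum_congr rfl fun z _ ↦ by rw [map_zsmul, map_zsmul, h z.1 (hmem z.1 z.2)]

/-! ### `[f_* Z] = f_* [Z]` (Prop. 9.21 (ii)) -/

/-- **`f_* (τ_y* 1) = [f_*[closure {y}]]` on prime cycles**: for `f : Y ⟶ X` between smooth projective
varieties and `y ∈ Y` of dimension `d`, `f_* [closure {y}]_ρ = [f_*[closure {y}]]_{ρ'}`, where
`f_*[closure {y}] = [κ(y):κ(f y)] [closure {f y}]` if the dimension is preserved and `0` otherwise
(Fulton §1.4): in the first case the degree formula for `g = τ_y ≫ f`, in the second semipurity.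
[cite: Fulton1998, §1.4 and Lemma 19.1.2] [cite: VoisinHodgeII2003, Prop. 9.21 (ii)] -/
theorem complexGysin_primeClass_eq {μ : OrientationFamily} (hμ : μ.HasDegreeFormula)
    (hY : Motives.IsSmoothProjective m Y) (hX : Motives.IsSmoothProjective n X) (f : Y ⟶ X)
    [QuasiCompact f.left] {d e e' : ℕ} (hde : d + e = m) (hde' : d + e' = n)
    (ρ : ResolutionFamily Y d) (ρ' : ResolutionFamily X d) (y : Y.left) (hy : height y = (d : ℕ∞)) :
    complexGysin μ hY hX f (show 2 * e + 2 * n = 2 * e' + 2 * m by omega) (primeClass μ hY hde ρ y) =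
      cycleClass μ hX hde' ρ' (Motives.cyclesOfDimMap d f.left
        ⟨Motives.primeCycle y, Motives.primeCycle_mem_cyclesOfDim hy⟩) := by
  classical
  have hf : IsClosedMap f.left.base :=
    haveI := isProper_left_of_isSmoothProjective hY hX f
    f.left.isClosedMap
  have hτ : IsClosedMap (ρ.hom ⟨y, hy⟩).left.base :=
    haveI := isProper_left_of_isSmoothProjective (ρ.smooth ⟨y, hy⟩) hY (ρ.hom ⟨y, hy⟩)
    (ρ.hom ⟨y, hy⟩).left.isClosedMap
  haveI : QuasiCompact ((ρ.hom ⟨y, hy⟩).left ≫ f.left) := inferInstance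
  haveI : QuasiCompact (ρ.hom ⟨y, hy⟩ ≫ f).left := by
    rw [Over.comp_left]; infer_instance
  -- `(τ_y ≫ f)_* 1 = f_* τ_y* 1`
  rw [primeClass_of_height_eq μ hY hde ρ hy, ← LinearMap.comp_apply,
    ← complexGysin_comp (OrientationFamily.hasPoincareDuality μ) (ρ.smooth ⟨y, hy⟩) hY hX
      (ρ.hom ⟨y, hy⟩) f (show 0 + 2 * m = 2 * e + 2 * d by omega)]
  -- the push-forward of the prime cycle
  have hmapτf : AlgebraicCycle.map (ρ.hom ⟨y, hy⟩ ≫ f).left height height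
      (Motives.primeCycle (ρ.gen ⟨y, hy⟩)) =
      AlgebraicCycle.mapCoeff f.left height height y • Motives.primeCycle (f.left.base y) := by
    have h2 : AlgebraicCycle.map ((ρ.hom ⟨y, hy⟩).left ≫ f.left) height height
        (Motives.primeCycle (ρ.gen ⟨y, hy⟩)) =
        AlgebraicCycle.mapCoeff f.left height height y • Motives.primeCycle (f.left.base y) := by
      rw [Motives.algebraicCycleMap_comp _ _ hτ hf, ρ.map_primeCycle,
        Motives.algebraicCycleMap_primeCycle_eq_nsmul]
    exact h2
  have hpush : (Motives.cyclesOfDimMap d f.left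
      ⟨Motives.primeCycle y, Motives.primeCycle_mem_cyclesOfDim hy⟩ : AlgebraicCycle X.left ℤ) =
      AlgebraicCycle.mapCoeff f.left height height y • Motives.primeCycle (f.left.base y) := by
    rw [Motives.coe_cyclesOfDimMap, Motives.algebraicCycleMap_primeCycle_eq_nsmul]
  by_cases hdim : height (f.left.base y) = height y
  · -- dimension preserved: degree formula with `k = [κ(y) : κ(f y)] ≥ 1`
    have hk : 0 < AlgebraicCycle.mapCoeff f.left height height y :=
      Nat.pos_of_ne_zero (mapCoeff_ne_zero_of_height_eq_of_isSmoothProjective hY hX f y hy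
        (by rw [hdim, hy]))
    have hmem' : Motives.primeCycle (f.left.base y) ∈ Motives.cyclesOfDim X.left d :=
      Motives.primeCycle_mem_cyclesOfDim (by rw [hdim, hy])
    have hval : Motives.cyclesOfDimMap d f.left
        ⟨Motives.primeCycle y, Motives.primeCycle_mem_cyclesOfDim hy⟩ =
        (AlgebraicCycle.mapCoeff f.left height height y : ℤ) •
          (⟨Motives.primeCycle (f.left.base y), hmem'⟩ : ↥(Motives.cyclesOfDim X.left d)) := by
      apply Subtype.ext
      rw [hpush, AddSubgroupClass.coe_zsmul, natCast_zsmul]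
    rw [hval, map_zsmul, complexGysin_one_eq_smul_cycleClass hμ hX hde' ρ' (ρ.smooth ⟨y, hy⟩)
      (ρ.hom ⟨y, hy⟩ ≫ f) (ρ.isGenericPoint_gen ⟨y, hy⟩) hk hmapτf hmem', natCast_zsmul,
      Nat.cast_smul_eq_nsmul]
  · -- dimension drops: both sides vanish
    have hcoeff : AlgebraicCycle.mapCoeff f.left height height y = 0 := by
      simp only [AlgebraicCycle.mapCoeff, if_neg (Ne.symm hdim)]
    have hval : Motives.cyclesOfDimMap d f.left
        ⟨Motives.primeCycle y, Motives.primeCycle_mem_cyclesOfDim hy⟩ = 0 := by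
      apply Subtype.ext
      rw [hpush, hcoeff, zero_smul, AddSubgroup.coe_zero]
    rw [hval, map_zero]
    have hlt : height ((ρ.hom ⟨y, hy⟩ ≫ f).left.base (ρ.gen ⟨y, hy⟩)) < (d : ℕ∞) := by
      change height (f.left.base ((ρ.hom ⟨y, hy⟩).left.base (ρ.gen ⟨y, hy⟩))) < (d : ℕ∞)
      rw [ρ.base_gen ⟨y, hy⟩]
      have hle : height (f.left.base y) ≤ height y := Motives.height_base_le_of_isClosedMap f.left hf y
      rw [hy] at hle hdim
      exact lt_of_le_of_ne hle hdim
    exact complexGysin_one_eq_zero_of_height_lt μ (ρ.smooth ⟨y, hy⟩) hX _ hde' _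
      (ρ.isGenericPoint_gen ⟨y, hy⟩) hlt

/-- **`[f_* Z] = f_* [Z]`** — the cycle class commutes with push-forward of cycles along a morphism
`f : Y ⟶ X` of smooth projective varieties (Voisin II Prop. 9.21 (ii): "If `i` is proper and
`Z ∈ CHᵏ(Y)`, then `cl(i_*Z) = i_* cl(Z)`"; Fulton §19.1: "`cl` commutes with push-forward for proper
morphisms"), for `cycleClass` through any resolution families, granted the degree formula for `μ` —
the field `cl_map` of `GysinFormalism`. [cite: VoisinHodgeII2003, Prop. 9.21 (ii)]
[cite: Fulton1998, Lemma 19.1.2 and §19.1] -/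
theorem cycleClass_cyclesOfDimMap {μ : OrientationFamily} (hμ : μ.HasDegreeFormula)
    (hY : Motives.IsSmoothProjective m Y) (hX : Motives.IsSmoothProjective n X) (f : Y ⟶ X)
    [QuasiCompact f.left] {d e e' : ℕ} (hde : d + e = m) (hde' : d + e' = n)
    (ρ : ResolutionFamily Y d) (ρ' : ResolutionFamily X d) (Z : ↥(Motives.cyclesOfDim Y.left d)) :
    cycleClass μ hX hde' ρ' (Motives.cyclesOfDimMap d f.left Z) =
      complexGysin μ hY hX f (show 2 * e + 2 * n = 2 * e' + 2 * m by omega)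
        (cycleClass μ hY hde ρ Z) := by
  have key : (cycleClass μ hX hde' ρ').comp (Motives.cyclesOfDimMap d f.left) =
      (complexGysin μ hY hX f (show 2 * e + 2 * n = 2 * e' + 2 * m by omega)).toAddMonoidHom.comp
        (cycleClass μ hY hde ρ) := by
    refine AddMonoidHom.cyclesOfDim_ext hY fun y hy ↦ ?_
    rw [AddMonoidHom.comp_apply, AddMonoidHom.comp_apply, LinearMap.toAddMonoidHom_coe,
      cycleClass_primeCycle_eq μ hY hde ρ y hy, ← primeClass_of_height_eq μ hY hde ρ hy,
      complexGysin_primeClass_eq hμ hY hX f hde hde' ρ ρ' y hy]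
  exact DFunLike.congr_fun key Z

end HodgeTheory

end Literature.AlgebraicGeometry.HodgeTheory

end
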